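import Literature.Geometry.Kaehler.ComplexTorusTranscendentalLatticeAllDegreesIsogeny
import Literature.Geometry.Kaehler.ComplexTorusRationalHodgeStructurePullback
import Mathlib.GroupTheory.IndexNSmul
import HarnessLib

/-!
# The transcendental lattice under an isogeny — index and discriminant: `f^* T_{X′} ⊆ T_X` has finite index dividing
# `e(f)^{l · rk T}` in every degree, and in the middle degree `[T_X : f^* T_{X′}]² · disc T_X = det ρ_r(f)^{rk T} · disc T_{X′}`

Layer `Literature/Geometry/Kaehler`, namespace `Literature.Geometry.Kaehler.ComplexTorus`; lane `lit-hodgefound` (Track 2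
foundations library), seat p09, generation 34, row g34-#2. THEOREMS ONLY (0 definitions); no named fact, net debt 0. Sequel of
g31-#12 `ComplexTorusTranscendentalLatticeAllDegreesIsogeny` (`⟨f^*x, f^*y⟩ = det ρ_r(f) · ⟨x, y⟩` in every bidegree, `f^* T′ ⊆ T`,
`e(f)ˡ · T ⊆ f^* T′`, `rk T_X = rk T_{X′}`, `f^*|_{T′}` injective with finite cokernel) for the degree-`l` transcendental lattice of
g31-#11,

  `T = T^l_{k,p}(X) = Hˡ(X, ℤ) ∩ ⋂_{s ∈ Hdg^{k,p}(X, ℤ)} ker ⟨s, ·⟩ = integralForms Φ l ⊓ ⨅ s, (ker (poincarePairing Φ e h s)).toAddSubgroup`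

(`k + l = |ι|`, written out, no definition), along an isogeny `f = ρ(A) : X = E/Φ(ℤ^ι) → X′ = E′/Φ′(ℤ^{ι′})` (`IsIsogeny Φ Φ′ A`,
exponent `e(f) = exp Ker f`, Lange Prop. 1.1.15). The pull-back of forms is the tree's `pullbackAlt (realRep Φ Φ′ A) l`
(`ψ ↦ ψ ∘ ρ(A)`), so `f^* T_{X′}` is the subgroup `T′.map (pullbackAlt (realRep Φ Φ′ A) l)`, and `[T_X : f^* T_{X′}]` is Mathlib's
relative index `(f^* T′).relIndex T`. This file turns g31-#12's inclusions into INDEX statements and adds the DISCRIMINANT relation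
of the middle degree:

* §1 (every degree) `f^* T′ ≤ T`, `e(f)ˡ · T ≤ f^* T′`, hence **`[T_X : f^* T_{X′}]` divides `(e(f)ˡ)^{rk T}`** (Mathlib's
  `AddSubgroup.relIndex_map_nsmul`: `[T : e T] = e^{rk T}`) and **is finite (non-zero)**; `f^* T′` read inside `T` is the range of
  g31-#12's injective `ℤ`-linear `f^*|_{T′} : T′ → T`.
* §2 (every bidegree) the integer Gram/pairing matrices scale: `⟨f^*xᵢ, f^*yⱼ⟩ = det(A_{ẽ′ẽ}) · ⟨xᵢ, yⱼ⟩` (g31-#12 §1 entrywise).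
* §3 (middle degree `k = l = m`, `m + m = |ι|`, where `T ⊂ Hᵐ(X, ℤ)` carries the integral symmetric/alternating form `⟨·,·⟩`):
  for `ℤ`-bases `t` of `T_X` and `t′` of `T_{X′}` on one index type `κ` (`rk T_X = rk T_{X′}`) with integer Gram matrices `G`, `G′`,
  **`[T_X : f^* T_{X′}]² · det G = det(A_{ẽ′ẽ})^{#κ} · det G′`** — Huybrechts' (0.1) "`disc Λ₁ = disc Λ · (Λ : Λ₁)²`" for the
  finite-index sublattice `Λ₁ = f^* T_{X′} ⊂ Λ = T_X`, whose Gram matrix in the basis `f^* t′` is `det(A) · G′` by §2 and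
  `Cᵀ G C` for the integer matrix `C` of `f^*` in the bases `t′, t` (`|det C| = [T_X : f^* T_{X′}]`, Mathlib's
  `AddSubgroup.index_eq_natAbs_det`); in particular `disc T_X · disc T_{X′} · det(A)^{rk T}` is a square.

## References

* [cite: Lange2023AbelianVarietiesComplex, §1.1.2 Prop. 1.1.13 (c) and Prop. 1.1.15 (PDF p. 22); §1.7.2 Cor. 1.7.6 (proof: "`∫_Y f^*ω = (Λ : ρ_r(f)(Λ′)) ∫_X ω`"); §6.2.4 (p. 310)]
* [cite: Huybrechts2016K3, Ch. 14 §0.1 (PDF p. 333: (0.1) "`disc Λ₁ = disc Λ · (Λ : Λ₁)²`" for a finite-index sublattice); Ch. 3 §2.2–2.3]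
* [cite: ShiodaMitani1974, §1 (1.5), §3 (3.19) and §4 p. 168 ("the Picard number `ρ(X)` does not change under isogeny")]
-/

noncomputable section

open Module Function

namespace Literature.Geometry.Kaehler.ComplexTorus

section IsogenyIndex

variable {ι ι' : Type*} [Fintype ι] [Fintype ι'] [DecidableEq ι] [DecidableEq ι']
  {E E' : Type*} [NormedAddCommGroup E] [NormedSpace ℂ E] [NormedAddCommGroup E'] [NormedSpace ℂ E']
  (Φ : (ι → ℝ) ≃L[ℝ] E) (Φ' : (ι' → ℝ) ≃L[ℝ] E') {n k l : ℕ} (e : Fin n ≃ ι) (e' : Fin n ≃ ι') (h : k + l = n) (p : ℕ)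

/-! ## §1 `[T_X : f^* T_{X′}]` is finite and divides `e(f)^{l · rk T}` -/

/-- **`f^* T_{X′} ⊆ T_X` in every degree, as subgroups of `Hˡ(X, ℂ)`** (`f^* = pullbackAlt (realRep Φ Φ′ A) l`; elementwise this
is g31-#12's `IsIsogeny.comp_realRep_mem_integralHodgeAnnihilator`). [cite: Lange2023AbelianVarietiesComplex, §1.1.2 Prop. 1.1.15 (PDF p. 22)] [cite: ShiodaMitani1974, §3 (3.19)] -/
theorem IsIsogeny.map_pullbackAlt_integralHodgeAnnihilator_le {A : Matrix ι' ι ℤ} (hf : IsIsogeny Φ Φ' A) :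
    (integralForms Φ' l ⊓ ⨅ s : integralHodgeClassesIn Φ' k p,
        (LinearMap.ker (poincarePairing Φ' e' h (s : E' [⋀^Fin k]→L[ℝ] ℂ))).toAddSubgroup).map
      (pullbackAlt (realRep Φ Φ' A) l).toAddMonoidHom ≤
    integralForms Φ l ⊓ ⨅ s : integralHodgeClassesIn Φ k p,
        (LinearMap.ker (poincarePairing Φ e h (s : E [⋀^Fin k]→L[ℝ] ℂ))).toAddSubgroup := by
  rintro _ ⟨t, ht, rfl⟩
  exact hf.comp_realRep_mem_integralHodgeAnnihilator Φ Φ' e e' h p ht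

/-- **`e(f)ˡ · T_X ⊆ f^* T_{X′}` in every degree, as subgroups** (`e(f)` the exponent of `Ker f`; elementwise g31-#12's
`IsIsogeny.exists_comp_realRep_eq_pow_smul_of_mem_integralHodgeAnnihilator`, `t′ = g^*t` for the quasi-inverse `g`, `gf = e_X`).
[cite: Lange2023AbelianVarietiesComplex, §1.1.2 Prop. 1.1.15 (PDF p. 22)] -/
theorem IsIsogeny.map_nsmul_integralHodgeAnnihilator_le_map_pullbackAlt {A : Matrix ι' ι ℤ} (hf : IsIsogeny Φ Φ' A) :
    (integralForms Φ l ⊓ ⨅ s : integralHodgeClassesIn Φ k p,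
        (LinearMap.ker (poincarePairing Φ e h (s : E [⋀^Fin k]→L[ℝ] ℂ))).toAddSubgroup).map
      (nsmulAddMonoidHom (AddMonoid.exponent (mapMatrixHom Φ Φ' A).ker ^ l)) ≤
    (integralForms Φ' l ⊓ ⨅ s : integralHodgeClassesIn Φ' k p,
        (LinearMap.ker (poincarePairing Φ' e' h (s : E' [⋀^Fin k]→L[ℝ] ℂ))).toAddSubgroup).map
      (pullbackAlt (realRep Φ Φ' A) l).toAddMonoidHom := by
  rintro _ ⟨t, ht, rfl⟩
  obtain ⟨t', ht', heq⟩ := hf.exists_comp_realRep_eq_pow_smul_of_mem_integralHodgeAnnihilator Φ Φ' e e' h p ht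
  refine ⟨t', ht', ?_⟩
  rw [nsmulAddMonoidHom_apply, LinearMap.toAddMonoidHom_coe, pullbackAlt_apply, heq, ← Nat.cast_smul_eq_nsmul ℂ, Nat.cast_pow]

omit [Fintype ι'] in
/-- **`f^* T_{X′}` read inside `T_X` is the range of g31-#12's injective `ℤ`-linear map `f^*|_{T′} : T_{X′} → T_X`.**
[cite: Lange2023AbelianVarietiesComplex, §1.1.2 Prop. 1.1.15 (PDF p. 22)] -/
theorem range_toAddSubgroup_eq_addSubgroupOf_map_pullbackAlt (A : Matrix ι' ι ℤ)
    (R : ↥(integralForms Φ' l ⊓ ⨅ s : integralHodgeClassesIn Φ' k p,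
          (LinearMap.ker (poincarePairing Φ' e' h (s : E' [⋀^Fin k]→L[ℝ] ℂ))).toAddSubgroup) →ₗ[ℤ]
        ↥(integralForms Φ l ⊓ ⨅ s : integralHodgeClassesIn Φ k p,
          (LinearMap.ker (poincarePairing Φ e h (s : E [⋀^Fin k]→L[ℝ] ℂ))).toAddSubgroup))
    (hR : ∀ t, (R t : E [⋀^Fin l]→L[ℝ] ℂ) = (t : E' [⋀^Fin l]→L[ℝ] ℂ).compContinuousLinearMap (realRep Φ Φ' A)) :
    (LinearMap.range R).toAddSubgroup =
      ((integralForms Φ' l ⊓ ⨅ s : integralHodgeClassesIn Φ' k p,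
          (LinearMap.ker (poincarePairing Φ' e' h (s : E' [⋀^Fin k]→L[ℝ] ℂ))).toAddSubgroup).map
        (pullbackAlt (realRep Φ Φ' A) l).toAddMonoidHom).addSubgroupOf
      (integralForms Φ l ⊓ ⨅ s : integralHodgeClassesIn Φ k p,
          (LinearMap.ker (poincarePairing Φ e h (s : E [⋀^Fin k]→L[ℝ] ℂ))).toAddSubgroup) := by
  ext x
  rw [Submodule.mem_toAddSubgroup, LinearMap.mem_range, AddSubgroup.mem_addSubgroupOf, AddSubgroup.mem_map]
  constructor
  · rintro ⟨s, rfl⟩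
    exact ⟨s, s.2, by rw [LinearMap.toAddMonoidHom_coe, pullbackAlt_apply, hR]⟩
  · rintro ⟨s, hs, hsx⟩
    refine ⟨⟨s, hs⟩, Subtype.ext ?_⟩
    rw [hR, ← hsx, LinearMap.toAddMonoidHom_coe, pullbackAlt_apply]

/-- **`[T_X : f^* T_{X′}]` divides `(e(f)ˡ)^{rk T_X}` in every degree** (`e(f)ˡ · T ⊆ f^* T′ ⊆ T` and `[T : e T] = e^{rk T}`,
Mathlib's `AddSubgroup.relIndex_map_nsmul`). [cite: Lange2023AbelianVarietiesComplex, §1.1.2 Prop. 1.1.13 (c) and Prop. 1.1.15 (PDF p. 22)] [cite: Huybrechts2016K3, Ch. 14 §0.1 (PDF p. 333)] -/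
theorem IsIsogeny.relIndex_map_pullbackAlt_integralHodgeAnnihilator_dvd {A : Matrix ι' ι ℤ} (hf : IsIsogeny Φ Φ' A) :
    ((integralForms Φ' l ⊓ ⨅ s : integralHodgeClassesIn Φ' k p,
          (LinearMap.ker (poincarePairing Φ' e' h (s : E' [⋀^Fin k]→L[ℝ] ℂ))).toAddSubgroup).map
        (pullbackAlt (realRep Φ Φ' A) l).toAddMonoidHom).relIndex
      (integralForms Φ l ⊓ ⨅ s : integralHodgeClassesIn Φ k p,
          (LinearMap.ker (poincarePairing Φ e h (s : E [⋀^Fin k]→L[ℝ] ℂ))).toAddSubgroup) ∣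
    (AddMonoid.exponent (mapMatrixHom Φ Φ' A).ker ^ l) ^
      finrank ℤ ↥(integralForms Φ l ⊓ ⨅ s : integralHodgeClassesIn Φ k p,
          (LinearMap.ker (poincarePairing Φ e h (s : E [⋀^Fin k]→L[ℝ] ℂ))).toAddSubgroup) := by
  haveI : Module.Free ℤ ↥(integralForms Φ l ⊓ ⨅ s : integralHodgeClassesIn Φ k p,
      (LinearMap.ker (poincarePairing Φ e h (s : E [⋀^Fin k]→L[ℝ] ℂ))).toAddSubgroup).toIntSubmodule :=
    moduleFree_integralHodgeAnnihilator Φ e h p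
  haveI : Module.Finite ℤ ↥(integralForms Φ l ⊓ ⨅ s : integralHodgeClassesIn Φ k p,
      (LinearMap.ker (poincarePairing Φ e h (s : E [⋀^Fin k]→L[ℝ] ℂ))).toAddSubgroup).toIntSubmodule :=
    moduleFinite_integralHodgeAnnihilator Φ e h p
  have h1 := AddSubgroup.relIndex_dvd_of_le_left
    (integralForms Φ l ⊓ ⨅ s : integralHodgeClassesIn Φ k p,
      (LinearMap.ker (poincarePairing Φ e h (s : E [⋀^Fin k]→L[ℝ] ℂ))).toAddSubgroup)
    (hf.map_nsmul_integralHodgeAnnihilator_le_map_pullbackAlt Φ Φ' e e' h p)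
  rwa [AddSubgroup.relIndex_map_nsmul] at h1

/-- **`[T_X : f^* T_{X′}]` is finite (non-zero) in every degree** for an isogeny `f`.
[cite: Lange2023AbelianVarietiesComplex, §1.1.2 Prop. 1.1.15 (PDF p. 22)] [cite: ShiodaMitani1974, §4 p. 168] -/
theorem IsIsogeny.relIndex_map_pullbackAlt_integralHodgeAnnihilator_ne_zero {A : Matrix ι' ι ℤ} (hf : IsIsogeny Φ Φ' A) :
    ((integralForms Φ' l ⊓ ⨅ s : integralHodgeClassesIn Φ' k p,
          (LinearMap.ker (poincarePairing Φ' e' h (s : E' [⋀^Fin k]→L[ℝ] ℂ))).toAddSubgroup).map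
        (pullbackAlt (realRep Φ Φ' A) l).toAddMonoidHom).relIndex
      (integralForms Φ l ⊓ ⨅ s : integralHodgeClassesIn Φ k p,
          (LinearMap.ker (poincarePairing Φ e h (s : E [⋀^Fin k]→L[ℝ] ℂ))).toAddSubgroup) ≠ 0 := by
  intro h0
  have h1 := hf.relIndex_map_pullbackAlt_integralHodgeAnnihilator_dvd Φ Φ' e e' h p (k := k) (l := l)
  rw [h0, zero_dvd_iff] at h1
  exact pow_ne_zero _ (pow_ne_zero _ hf.exponent_ker_pos.ne') h1

/-! ## §2 The pairing matrices scale by `det ρ_r(f)` -/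

/-- **`⟨f^*xᵢ, f^*yⱼ⟩_e = det(A_{ẽ′ẽ}) · ⟨xᵢ, yⱼ⟩_{e′}`** for families `x : κ → Hᵏ(X′, ℂ)`, `y : κ′ → Hˡ(X′, ℂ)` with an INTEGER
pairing matrix `M′ i j = ⟨xᵢ, yⱼ⟩`: the pairing matrix of the pulled-back families is `det(A_{ẽ′ẽ}) · M′` (g31-#12 §1 entrywise;
`ẽ = (finCongr h).trans e`). [cite: Lange2023AbelianVarietiesComplex, §1.7.2 Cor. 1.7.6 (proof) and §6.2.4 (p. 310)] [cite: ShiodaMitani1974, §1 (1.5)] -/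
theorem cast_det_mul_eq_poincarePairing_comp_realRep (A : Matrix ι' ι ℤ) {κ κ' : Type*}
    (x : κ → E' [⋀^Fin k]→L[ℝ] ℂ) (y : κ' → E' [⋀^Fin l]→L[ℝ] ℂ) (M' : Matrix κ κ' ℤ)
    (hM' : ∀ i j, (M' i j : ℂ) = poincarePairing Φ' e' h (x i) (y j)) (i : κ) (j : κ') :
    (((A.submatrix ((finCongr h).trans e') ((finCongr h).trans e)).det * M' i j : ℤ) : ℂ) =
      poincarePairing Φ e h ((x i).compContinuousLinearMap (realRep Φ Φ' A)) ((y j).compContinuousLinearMap (realRep Φ Φ' A)) := by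
  rw [Int.cast_mul, hM', poincarePairing_comp_realRep_comp_realRep]

end IsogenyIndex

/-! ## §3 Middle degree: `[T_X : f^* T_{X′}]² · disc T_X = det(A_{ẽ′ẽ})^{rk T} · disc T_{X′}` -/

section MiddleDiscriminant

variable {ι ι' : Type*} [Fintype ι] [Fintype ι'] [DecidableEq ι] [DecidableEq ι']
  {E E' : Type*} [NormedAddCommGroup E] [NormedSpace ℂ E] [NormedAddCommGroup E'] [NormedSpace ℂ E']
  (Φ : (ι → ℝ) ≃L[ℝ] E) (Φ' : (ι' → ℝ) ≃L[ℝ] E') {n m : ℕ} (e : Fin n ≃ ι) (e' : Fin n ≃ ι') (h : m + m = n) (p : ℕ)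

/-- **Huybrechts' (0.1) for `f^* T_{X′} ⊂ T_X` in the middle degree: `[T_X : f^* T_{X′}]² · det G = det(A_{ẽ′ẽ})^{#κ} · det G′`**
for an isogeny `f = ρ(A) : X → X′` of tori of even dimension `m`, `ℤ`-bases `t : κ → T_X`, `t′ : κ → T_{X′}` of the middle
transcendental lattices `T ⊂ Hᵐ(·, ℤ)` (annihilators of `Hdg^{m,p}(·, ℤ)`, `rk T_X = rk T_{X′}` by g31-#12) and their integer Gram
matrices `G i j = ⟨tᵢ, tⱼ⟩_e`, `G′ i j = ⟨t′ᵢ, t′ⱼ⟩_{e′}`: the sublattice `f^* T_{X′} ⊂ T_X` has the basis `f^* t′` with Gram matrix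
`det(A_{ẽ′ẽ}) · G′` (§2) `= Cᵀ G C` for the integer matrix `C` of `f^*` in the bases `t′`, `t`, and `|det C| = [T_X : f^* T_{X′}]`.
[cite: Huybrechts2016K3, Ch. 14 §0.1 (PDF p. 333: (0.1) "`disc Λ₁ = disc Λ · (Λ : Λ₁)²`")] [cite: Lange2023AbelianVarietiesComplex, §1.1.2 proof of Prop. 1.1.13 (c) (PDF p. 22) and §1.7.2 Cor. 1.7.6] [cite: ShiodaMitani1974, §1 (1.5) and §4] -/
theorem IsIsogeny.relIndex_sq_mul_det_gram_eq {A : Matrix ι' ι ℤ} (hf : IsIsogeny Φ Φ' A) {κ : Type*} [Fintype κ] [DecidableEq κ]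
    (t : Basis κ ℤ ↥(integralForms Φ m ⊓ ⨅ s : integralHodgeClassesIn Φ m p,
        (LinearMap.ker (poincarePairing Φ e h (s : E [⋀^Fin m]→L[ℝ] ℂ))).toAddSubgroup))
    (t' : Basis κ ℤ ↥(integralForms Φ' m ⊓ ⨅ s : integralHodgeClassesIn Φ' m p,
        (LinearMap.ker (poincarePairing Φ' e' h (s : E' [⋀^Fin m]→L[ℝ] ℂ))).toAddSubgroup))
    (G G' : Matrix κ κ ℤ)
    (hG : ∀ i j, (G i j : ℂ) = poincarePairing Φ e h (t i : E [⋀^Fin m]→L[ℝ] ℂ) (t j : E [⋀^Fin m]→L[ℝ] ℂ))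
    (hG' : ∀ i j, (G' i j : ℂ) = poincarePairing Φ' e' h (t' i : E' [⋀^Fin m]→L[ℝ] ℂ) (t' j : E' [⋀^Fin m]→L[ℝ] ℂ)) :
    ((((integralForms Φ' m ⊓ ⨅ s : integralHodgeClassesIn Φ' m p,
            (LinearMap.ker (poincarePairing Φ' e' h (s : E' [⋀^Fin m]→L[ℝ] ℂ))).toAddSubgroup).map
          (pullbackAlt (realRep Φ Φ' A) m).toAddMonoidHom).relIndex
        (integralForms Φ m ⊓ ⨅ s : integralHodgeClassesIn Φ m p,
            (LinearMap.ker (poincarePairing Φ e h (s : E [⋀^Fin m]→L[ℝ] ℂ))).toAddSubgroup) : ℕ) : ℤ) ^ 2 * G.det =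
      (A.submatrix ((finCongr h).trans e') ((finCongr h).trans e)).det ^ Fintype.card κ * G'.det := by
  classical
  obtain ⟨R, hR, hRinj⟩ := hf.exists_intLinearMap_integralHodgeAnnihilator_injective Φ Φ' e e' h p (k := m) (l := m)
  -- `f^* T′` inside `T` is the range of `R = f^*|_{T′}`, with basis `R ∘ t′`
  have hrange := range_toAddSubgroup_eq_addSubgroupOf_map_pullbackAlt Φ Φ' e e' h p A R hR
  let bN : Basis κ ℤ (LinearMap.range R) := t'.map (LinearEquiv.ofInjective R hRinj)
  have hbN : ∀ j, ((bN j : LinearMap.range R) : ↥(integralForms Φ m ⊓ ⨅ s : integralHodgeClassesIn Φ m p,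
      (LinearMap.ker (poincarePairing Φ e h (s : E [⋀^Fin m]→L[ℝ] ℂ))).toAddSubgroup)) = R (t' j) := fun j ↦ by
    rw [Basis.map_apply, LinearEquiv.ofInjective_apply]
  -- the integer matrix `C` of `f^*` in the bases `t′`, `t`; `|det C| = [T : f^* T′]`
  set C : Matrix κ κ ℤ := t.toMatrix (fun j ↦ R (t' j)) with hC
  have hidx : ((integralForms Φ' m ⊓ ⨅ s : integralHodgeClassesIn Φ' m p,
            (LinearMap.ker (poincarePairing Φ' e' h (s : E' [⋀^Fin m]→L[ℝ] ℂ))).toAddSubgroup).map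
          (pullbackAlt (realRep Φ Φ' A) m).toAddMonoidHom).relIndex
        (integralForms Φ m ⊓ ⨅ s : integralHodgeClassesIn Φ m p,
            (LinearMap.ker (poincarePairing Φ e h (s : E [⋀^Fin m]→L[ℝ] ℂ))).toAddSubgroup) = C.det.natAbs := by
    rw [AddSubgroup.relIndex, ← hrange, AddSubgroup.index_eq_natAbs_det t (LinearMap.range R).toAddSubgroup bN, Basis.det_apply,
      hC, show (fun j ↦ ((bN j : LinearMap.range R) : ↥(integralForms Φ m ⊓ ⨅ s : integralHodgeClassesIn Φ m p,
        (LinearMap.ker (poincarePairing Φ e h (s : E [⋀^Fin m]→L[ℝ] ℂ))).toAddSubgroup))) = fun j ↦ R (t' j) from funext hbN]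
  -- `R (t′ⱼ) = Σ_b C_{b j} t_b`, read on forms
  have hRsum : ∀ j, ((R (t' j) : ↥(integralForms Φ m ⊓ ⨅ s : integralHodgeClassesIn Φ m p,
      (LinearMap.ker (poincarePairing Φ e h (s : E [⋀^Fin m]→L[ℝ] ℂ))).toAddSubgroup)) : E [⋀^Fin m]→L[ℝ] ℂ) =
      ∑ b, ((C b j : ℤ) : ℂ) • ((t b : ↥(integralForms Φ m ⊓ ⨅ s : integralHodgeClassesIn Φ m p,
        (LinearMap.ker (poincarePairing Φ e h (s : E [⋀^Fin m]→L[ℝ] ℂ))).toAddSubgroup)) : E [⋀^Fin m]→L[ℝ] ℂ) := by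
    intro j
    have h1 := congrArg (fun z : ↥(integralForms Φ m ⊓ ⨅ s : integralHodgeClassesIn Φ m p,
      (LinearMap.ker (poincarePairing Φ e h (s : E [⋀^Fin m]→L[ℝ] ℂ))).toAddSubgroup) ↦ (z : E [⋀^Fin m]→L[ℝ] ℂ))
      (t.sum_repr (R (t' j))).symm
    simp only [AddSubmonoidClass.coe_finsetSum, AddSubgroupClass.coe_zsmul] at h1
    rw [h1]
    refine Finset.sum_congr rfl fun b _ ↦ ?_
    rw [hC, Basis.toMatrix_apply]
    exact (Int.cast_smul_eq_zsmul ℂ _ _).symm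
  -- the Gram matrix of `f^* t′`: `Cᵀ G C = det(A) • G′`
  have hgram : C.transpose * G * C = (A.submatrix ((finCongr h).trans e') ((finCongr h).trans e)).det • G' := by
    ext i j
    apply Int.cast_injective (α := ℂ)
    rw [Matrix.smul_apply, smul_eq_mul, cast_det_mul_eq_poincarePairing_comp_realRep Φ Φ' e e' h A _ _ G' hG' i j,
      ← hR, ← hR, hRsum i, hRsum j]
    simp only [map_sum, map_smul, LinearMap.sum_apply, LinearMap.smul_apply, smul_eq_mul, Matrix.mul_apply,
      Matrix.transpose_apply, Int.cast_sum, Int.cast_mul, Finset.sum_mul, ← hG]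
    refine Finset.sum_congr rfl fun b _ ↦ ?_
    rw [Finset.mul_sum]
    refine Finset.sum_congr rfl fun a _ ↦ ?_
    ring
  -- determinants
  have hdet := congrArg Matrix.det hgram
  rw [Matrix.det_mul, Matrix.det_mul, Matrix.det_transpose, Matrix.det_smul] at hdet
  rw [hidx, Int.natAbs_sq, ← hdet]
  ring

/-- **Corollary: `disc T_X · disc T_{X′} · det(A_{ẽ′ẽ})^{rk T}` is a perfect square** (`= ([T_X : f^* T_{X′}] · det G)²`), for
isogenous middle transcendental lattices with Gram matrices `G`, `G′` as above. [cite: Huybrechts2016K3, Ch. 14 §0.1 (PDF p. 333)] [cite: ShiodaMitani1974, §4] -/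
theorem IsIsogeny.isSquare_det_gram_mul_det_gram_mul_det_pow {A : Matrix ι' ι ℤ} (hf : IsIsogeny Φ Φ' A) {κ : Type*} [Fintype κ]
    [DecidableEq κ]
    (t : Basis κ ℤ ↥(integralForms Φ m ⊓ ⨅ s : integralHodgeClassesIn Φ m p,
        (LinearMap.ker (poincarePairing Φ e h (s : E [⋀^Fin m]→L[ℝ] ℂ))).toAddSubgroup))
    (t' : Basis κ ℤ ↥(integralForms Φ' m ⊓ ⨅ s : integralHodgeClassesIn Φ' m p,
        (LinearMap.ker (poincarePairing Φ' e' h (s : E' [⋀^Fin m]→L[ℝ] ℂ))).toAddSubgroup))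
    (G G' : Matrix κ κ ℤ)
    (hG : ∀ i j, (G i j : ℂ) = poincarePairing Φ e h (t i : E [⋀^Fin m]→L[ℝ] ℂ) (t j : E [⋀^Fin m]→L[ℝ] ℂ))
    (hG' : ∀ i j, (G' i j : ℂ) = poincarePairing Φ' e' h (t' i : E' [⋀^Fin m]→L[ℝ] ℂ) (t' j : E' [⋀^Fin m]→L[ℝ] ℂ)) :
    IsSquare (G.det * G'.det * (A.submatrix ((finCongr h).trans e') ((finCongr h).trans e)).det ^ Fintype.card κ) := by
  have key := hf.relIndex_sq_mul_det_gram_eq Φ Φ' e e' h p t t' G G' hG hG'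
  refine ⟨(((integralForms Φ' m ⊓ ⨅ s : integralHodgeClassesIn Φ' m p,
            (LinearMap.ker (poincarePairing Φ' e' h (s : E' [⋀^Fin m]→L[ℝ] ℂ))).toAddSubgroup).map
          (pullbackAlt (realRep Φ Φ' A) m).toAddMonoidHom).relIndex
        (integralForms Φ m ⊓ ⨅ s : integralHodgeClassesIn Φ m p,
            (LinearMap.ker (poincarePairing Φ e h (s : E [⋀^Fin m]→L[ℝ] ℂ))).toAddSubgroup) : ℤ) * G.det, ?_⟩
  linear_combination (-G.det) * key

end MiddleDiscriminant

end Literature.Geometry.Kaehler.ComplexTorus
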